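import Summits.FinalStateConjecture.FinalStateConjecture.Theorems.PhotonSphereChannelsEndVisibleOuterRegion
import Summits.FinalStateConjecture.FinalStateConjecture.Statement
import Literature.Geometry.Lorentzian.FinalState
import HarnessLib

/-!
# Stub `stub_visibleRaysStay` of line `birth` of crux `SettledCapture` (stmt-FinalStateConjecture-17328):
# visible points of rays lie in the closure of the settled exterior

Stub 3 of the birth skeleton of crux `SettledCapture` (route `BartnikGapSettling`, summit
`FinalStateConjecture`), a lemma of pure causal theory (no dynamics). For a vacuum Cauchy
development `𝒟`, a final-state decomposition `d` of `O = exteriorOf 𝒟 d.charted = J⁺(ι X) ∩ I⁻(d.charted)`,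
and a normalised null ray `γ` from the data hypersurface with affine domain `dom`: if `0 ≤ t ≤ t'`
lie in `dom` and the later point `γ t'` is visible, `γ t' ∈ closure d.charted`, then
`γ t ∈ closure O`.

Proof. `d.charted ⊆ closure I⁻(d.charted)` (`A ⊆ cl I⁻(A)` on a manifold without boundary,
O'Neill Lemma 14.6 (2), time dual), so `γ t' ∈ closure I⁻(d.charted)`; `I⁻(d.charted)` is a past
set, and along a ray membership in the closure of a past set passes down the parameter (push-up,
O'Neill Cor. 14.1: `EndVisible.mem_closure_of_le_of_isPastSet`), so `γ s ∈ closure I⁻(d.charted)`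
for every `s ≤ t'` in `dom`. For `s > 0` the ray point lies in the open `I⁺(ι X) ⊆ J⁺(ι X)`
(O'Neill Lemma 14.3; `EndVisible.mem_closure_inter_causalFuture_of_pos`), whence
`γ s ∈ closure (J⁺(ι X) ∩ I⁻(d.charted)) = closure O`. The endpoint `t = 0` follows by continuity
of the ray from the right (`γ 0 = lim_{s ↓ 0} γ s`), or, if also `t' = 0`, from `d.charted ⊆ O`.

References: O'Neill 1983, Ch. 14, Lemma 14.3 (p. 403), Lemma 14.6 (2), Cor. 14.1 (p. 402).
-/

-- the doubled FinalStateConjecture path component is the summit/problem naming scheme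
set_option linter.dupNamespace false

namespace Summit.FinalStateConjecture.FinalStateConjecture.Theorems.BartnikGapSettling.SettledCapture

open Set Filter Topology
open scoped Manifold ContDiff ENNReal
open Literature.Geometry.Lorentzian

/-- **Visible points of rays lie in `closure O`** (stub `stub_visibleRaysStay` of line `birth`,
crux `SettledCapture`, stmt-FinalStateConjecture-17328): with `O = exteriorOf 𝒟 d.charted =
J⁺(ι X) ∩ I⁻(d.charted)`, a point `γ t`, `t ≥ 0`, of a normalised null ray from `Σ` which at some
later parameter `t' ≥ t` lies in `closure d.charted` is in `closure O` (push-up along the ray for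
the past set `I⁻(d.charted)`, openness of `I⁺(ι X)`, and right-continuity of the ray at `t = 0`).
[cite: ONeillSemiRiemannian1983, Ch. 14, Cor. 14.1 (p. 402)] -/
theorem stub_visibleRaysStay : ∀ (X : Type) [TopologicalSpace X] [ChartedSpace E3 X] [IsManifold (𝓡 3) ((⊤ : ℕ∞) : WithTop ℕ∞) X] [T2Space X] [SecondCountableTopology X] [ConnectedSpace X], ∀ D ∈ admissibleVacuumData X, ∀ 𝒟 : VacuumCauchyDevelopment D, ∀ (O : Set 𝒟.carrier) (d : FinalStateDecomposition 𝒟.toSpacetime O 2), O = Summit.FinalStateConjecture.exteriorOf 𝒟.toCauchyDevelopment d.charted → ∀ [𝒟.metric.HasLeviCivita], ∀ (p : X) (γ : ℝ → 𝒟.carrier) (dom : Set ℝ), 𝒟.metric.IsNormalisedNullRayFrom 𝒟.timeOrientation 𝒟.embed 𝒟.normal p γ dom → ∀ t ∈ dom, ∀ t' ∈ dom, 0 ≤ t → t ≤ t' → γ t' ∈ closure d.charted → γ t ∈ closure O := by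
  intro X _ _ _ _ _ _ D _ 𝒟 O d hO _ p γ dom hγ t ht t' ht' h0 htt' hvis
  -- `I⁻(d.charted)` is a past set
  have hP : 𝒟.metric.IsPastSet 𝒟.timeOrientation
      (𝒟.metric.chronologicalPast 𝒟.timeOrientation d.charted) :=
    LorentzianMetric.isPastSet_chronologicalPast d.charted
  -- `d.charted ⊆ closure I⁻(d.charted)`, hence `γ t' ∈ closure I⁻(d.charted)`
  have hsub : d.charted ⊆ closure (𝒟.metric.chronologicalPast 𝒟.timeOrientation d.charted) :=
    𝒟.metric.subset_closure_chronologicalFuture 𝒟.timeOrientation.reverse d.charted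
  have hcl : γ t' ∈ closure (𝒟.metric.chronologicalPast 𝒟.timeOrientation d.charted) := by
    have h := closure_mono hsub hvis
    rwa [closure_closure] at h
  -- push-up: every earlier ray point lies in `closure I⁻(d.charted)`
  have hall : ∀ s ∈ dom, s ≤ t' →
      γ s ∈ closure (𝒟.metric.chronologicalPast 𝒟.timeOrientation d.charted) :=
    fun s hs hst' ↦ EndVisible.mem_closure_of_le_of_isPastSet hP hγ hs ht' hst' hcl
  -- positive parameters: intersect with the open `I⁺(ι X) ⊆ J⁺(ι X)`
  have hpos : ∀ s ∈ dom, 0 < s → s ≤ t' → γ s ∈ closure O := by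
    intro s hs hs0 hst'
    have h1 := EndVisible.mem_closure_inter_causalFuture_of_pos hγ hs hs0 (hall s hs hst')
    rw [hO]
    unfold Summit.FinalStateConjecture.exteriorOf
    rwa [inter_comm] at h1
  rcases h0.eq_or_lt with rfl | ht0
  · rcases htt'.eq_or_lt with rfl | ht'0
    · -- `t = t' = 0`: `closure d.charted ⊆ closure O`
      exact closure_mono d.charted_subset hvis
    · -- `t = 0 < t'`: `γ 0 = lim_{s ↓ 0} γ s` with `γ s ∈ closure O` for `0 < s < t'`
      have hc : Tendsto γ (𝓝[>] 0) (𝓝 (γ 0)) :=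
        (EndVisible.continuousAt_of_isNormalisedNullRayFrom hγ hγ.zero_mem).tendsto.mono_left
          nhdsWithin_le_nhds
      have hev : ∀ᶠ s in 𝓝[>] (0 : ℝ), γ s ∈ closure O := by
        filter_upwards [Ioo_mem_nhdsGT ht'0] with s hs
        exact hpos s (hγ.isMaximalGeodesicOn.2.1.out hγ.zero_mem ht' ⟨hs.1.le, hs.2.le⟩) hs.1
          hs.2.le
      have h := mem_closure_of_tendsto hc hev
      rwa [closure_closure] at h
  · exact hpos t ht ht0 htt'

end Summit.FinalStateConjecture.FinalStateConjecture.Theorems.BartnikGapSettling.SettledCapture
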